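import Summits.QuantumFields.YangMills.Theorems.ParabolicTrajectoryLatticeGapOnTrajectoryStepScalingDefs
import Summits.QuantumFields.YangMills.Theorems.ParabolicTrajectoryLatticeGapOnTrajectoryTransferHankelSiteStrict
import Summits.QuantumFields.YangMills.Theorems.ParabolicTrajectoryLatticeGapOnTrajectoryStubNegReflectRP
import Summits.QuantumFields.YangMills.Theorems.ParabolicTrajectoryLatticeGapOnTrajectorySlabClusteringOS
import Summits.QuantumFields.YangMills.Theorems.ParabolicTrajectoryLatticeGapOnTrajectoryStubSmoothingToGapHelpers
import HarnessLib

/-!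
# Crux `LatticeGapOnTrajectory` (stmt-QuantumFields-10523): the format step, gap half
# (stub `stub_formatGap`, line `step-scaling-contraction`, served slug `StepScalingSketch`)

Helper file (`--supports stmt-QuantumFields-10523`) proving the registered stub `stub_formatGap` of the
skeleton `Cruxes/LatticeGapOnTrajectory/Lines/step_scaling_contraction.lean` (signature verbatim): a rate
floor (`TorusGapAt` at the lattice rate `Δ · a_k` on EVERY symmetric torus `S ≥ M^{n_k}`, eventually in `k`)
gives the summit's per-pair sup-norm lattice gap `HasLatticeMassGap r sch Δ`. G-blind plumbing: §1 geometry of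
the torus time shift (composition, periodicity, species-shaped supports shifted into slabs, a slab read on the
reflected field); §2 on one torus the connected correlation `∫ f (g ∘ τ_n) − ∫ f ∫ g` IS, for `2w₀ + 3 ≤ n ≤ S`,
the reflected OS correlation `osCorr μ Θ₀ τ_{n−2w₀−3} X Y` of two `[1, 2w₀+2]`-slab observables (translation and
`Θ₀` invariance of Wilson's torus measure), bounded by multiplicative polarisation on the reflection-positive
class of slab observables (`stub_negReflectRP`) with the diagonal bound `TorusGapAt`; small `n` trivially;
§3 the eventualities in `k`.

References: Osterwalder–Seiler, Ann. Phys. 110 (1978) 440, §2; Glimm–Jaffe, Quantum Physics (1987), §6.1,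
§19.7.
-/

open scoped ComplexConjugate Topology
open Filter MeasureTheory
open Literature.MathematicalPhysics.QuantumLattice Literature.MathematicalPhysics.QuantumFieldTheory
open Summit.QuantumFields.YangMills.Theses.ParabolicTrajectory
open Summit.QuantumFields.YangMills.Cruxes.LatticeGapOnTrajectory.OrbitKantorovichFiniteSize
open Summit.QuantumFields.YangMills.Theorems.LatticeGapOnTrajectory

noncomputable section

namespace Summit.QuantumFields.YangMills.Cruxes.LatticeGapOnTrajectory.StepScaling

/-! ## §1 Geometry of slab observables on the torus: time shifts, wrap-around, reflection -/

section Geometry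

variable {G : Type} [MeasurableSpace G] {Sd : ℕ}

/-- Composing two torus time shifts: `τ_a (τ_b U) = τ_{a+b} U`. -/
theorem torusTimeShift_torusTimeShift (a b : ℕ) (U : GaugeConfig 4 Sd G) :
    torusTimeShift Sd a (torusTimeShift Sd b U) = torusTimeShift Sd (a + b) U := by
  funext e
  simp only [Transfer.Hankel.torusTimeShift_apply, Nat.cast_add, Pi.single_add, add_assoc]

/-- The time shift `τ_a` depends on `a` only through its residue mod `Sd` (periodicity of the torus). -/
theorem torusTimeShift_congr {a b : ℕ} (h : (a : ZMod Sd) = (b : ZMod Sd)) (U : GaugeConfig 4 Sd G) :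
    torusTimeShift Sd a U = torusTimeShift Sd b U := by
  funext e
  simp only [Transfer.Hankel.torusTimeShift_apply, h]

/-- **Shifting a species-shaped observable into a slab.** If `X` depends only on the links based at the
lattice times `t mod Sd`, `|t| ≤ w₀` (the support shape of a species of time half-width `w₀`, wrapping around
the torus), and `a + w₀ ≤ j`, `j + w₀ ≤ b < Sd` (no wrap-around after the shift), then `X ∘ τ_j` depends only
on the links based at lattice times `a … b`. -/
theorem dependsOn_comp_torusTimeShift_slab [NeZero Sd] {α : Type*} {X : GaugeConfig 4 Sd G → α} {w₀ : ℕ}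
    (hX : DependsOn X {e : Edge 4 Sd | ∃ t : ℤ, |t| ≤ w₀ ∧ e.1 0 = (t : ZMod Sd)}) {j a b : ℕ}
    (ha : a + w₀ ≤ j) (hb : j + w₀ ≤ b) (hbS : b < Sd) :
    DependsOn (fun U => X (torusTimeShift Sd j U))
      {e : Edge 4 Sd | a ≤ (e.1 0).val ∧ (e.1 0).val ≤ b} := by
  intro U V hUV
  apply hX
  rintro e ⟨t, ht, he⟩
  rw [Transfer.Hankel.torusTimeShift_apply, Transfer.Hankel.torusTimeShift_apply]
  apply hUV
  obtain ⟨hlo, hhi⟩ := abs_le.1 ht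
  obtain ⟨u, hu⟩ : ∃ u : ℕ, (u : ℤ) = j + t := ⟨(j + t).toNat, Int.toNat_of_nonneg (by omega)⟩
  have h0 : (e.1 + Pi.single (0 : Fin 4) (j : ZMod Sd) : Site 4 Sd) 0 = ((u : ℕ) : ZMod Sd) := by
    rw [← Int.cast_natCast u, hu]
    simp only [Pi.add_apply, Pi.single_eq_same, he]
    push_cast
    ring
  simp only [Set.mem_setOf_eq, h0, ZMod.val_natCast_of_lt (show u < Sd by omega)]
  omega

/-- A species whose support has time half-width `≤ w₀`, read on the periodic lift, depends only on the links
based at the lattice times `t mod Sd`, `|t| ≤ w₀`. -/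
theorem dependsOn_torusLift_near [Group G] {A : YMSpecies G} {w₀ : ℕ}
    (hw : ∀ e ∈ A.supp, |e.1 0| ≤ (w₀ : ℤ)) (Sd : ℕ) :
    DependsOn (fun U : GaugeConfig 4 Sd G => A.F (torusLift Sd U))
      {e : Edge 4 Sd | ∃ t : ℤ, |t| ≤ w₀ ∧ e.1 0 = (t : ZMod Sd)} := by
  intro U V hUV
  apply Negative.dependsOn_comp_torusLift A.isCylinder Sd
  intro e he
  obtain ⟨e₀, he₀, rfl⟩ := Finset.mem_image.1 (Finset.mem_coe.1 he)
  exact hUV _ ⟨e₀.1 0, hw e₀ he₀, by simp [torusEdge]⟩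

omit [MeasurableSpace G] in
/-- **Mirror image of `SlabClustering.dependsOn_comp_negReflect_slab`.** If `X` depends only on the links based
at lattice times `a … b` with `1 ≤ a`, `b ≤ 2L` (torus of side `2L+1`), then `X ∘ Θ₀` depends only on the
links based at times `2L − b … 2L + 1 − a` (spatial links at `u ↦ −u`, temporal links based at `u ↦ −u−1`). -/
theorem dependsOn_comp_negReflect_slab' [Group G] {L : ℕ} {α : Type*}
    {X : GaugeConfig 4 (2 * L + 1) G → α} {a b : ℕ} (ha : 1 ≤ a) (hb : b ≤ 2 * L)
    (hX : DependsOn X {e : Edge 4 (2 * L + 1) | a ≤ (e.1 0).val ∧ (e.1 0).val ≤ b}) :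
    DependsOn (fun U => X (GaugeConfig.negReflect U))
      {e : Edge 4 (2 * L + 1) | 2 * L - b ≤ (e.1 0).val ∧ (e.1 0).val ≤ 2 * L + 1 - a} := by
  -- adapted from `SlabClustering.dependsOn_comp_negReflect_slab`
  intro U V hUV
  apply hX
  intro e he
  simp only [Set.mem_setOf_eq] at he
  obtain ⟨x, i⟩ := e
  set t : ℕ := (x 0).val with ht
  have hxt : x 0 = (t : ZMod (2 * L + 1)) := (ZMod.natCast_zmod_val (x 0)).symm
  show GaugeConfig.negReflect U (x, i) = GaugeConfig.negReflect V (x, i)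
  unfold GaugeConfig.negReflect
  by_cases hi : i = 0
  · simp only [hi, ↓reduceIte]
    rw [hUV _ ?_]
    simp only [Set.mem_setOf_eq, WilsonSiteRP.negReflect_apply_zero, WilsonRP.shift_apply_self, hxt]
    rw [← Nat.cast_succ, SlabClustering.val_neg_natCast (by omega) (by omega)]
    omega
  · simp only [hi, ↓reduceIte]
    rw [hUV _ ?_]
    simp only [Set.mem_setOf_eq, WilsonSiteRP.negReflect_apply_zero, hxt]
    rw [SlabClustering.val_neg_natCast (by omega) (by omega)]
    omega

end Geometry

/-! ## §2 One torus: the connected correlation as a reflected OS correlation, polarised -/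

section Torus

variable {G : Type} [Group G] [TopologicalSpace G] [IsTopologicalGroup G] [CompactSpace G]
  [MeasurableSpace G] [BorelSpace G]

/-- The connected torus correlation of `latticeConnectedCorr` through the torus time shift `τ_n`
(`torusLift_torusTimeShift`). -/
theorem latticeConnectedCorr_eq_torusTimeShift {N : ℕ} (ρ : G →* Matrix (Fin N) (Fin N) ℂ) (β : ℝ)
    (Sd : ℕ) [NeZero Sd] (A B : LGConfig 4 G → ℝ) (n : ℕ) :
    latticeConnectedCorr ρ β Sd A B n =
      (∫ U, A (torusLift Sd U) * B (torusLift Sd (torusTimeShift Sd n U)) ∂(wilsonMeasure ρ β)) -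
        (∫ U, A (torusLift Sd U) ∂(wilsonMeasure ρ β)) * ∫ U, B (torusLift Sd U) ∂(wilsonMeasure ρ β) := by
  unfold latticeConnectedCorr
  simp_rw [torusLift_torusTimeShift]

/-- **Far case on one torus.** Let `μ = wilsonMeasure r.ρ β` (`β ≥ 0`) on the torus of side `2S+1`, assume
`TorusGapAt r.ρ β S m κ` (`m, κ ≥ 0`), and let `f`, `g` be bounded measurable real observables depending only
on the links based at the lattice times `t mod 2S+1`, `|t| ≤ w₀`, `2w₀ + 3 ≤ S`. For `2w₀ + 3 ≤ n ≤ S`,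
`∫ f · (g ∘ τ_n) dμ − ∫ f dμ ∫ g dμ = osCorr μ Θ₀ τ_{n−2w₀−3} X Y` with the `[1, 2w₀+2]`-slab observables
`X = f ∘ τ_{2S−w₀−1} ∘ Θ₀`, `Y = g ∘ τ_{w₀+1}` (translation and `Θ₀` invariance of `μ`); multiplicative polarisation
on the reflection-positive class of slab observables (`stub_negReflectRP`) with `TorusGapAt` on the diagonal
gives `|…| ≤ (4(‖f‖² + ‖g‖²) + κ(‖f‖ + ‖g‖)²) e^{m(2w₀+3)} e^{−mn}`. -/
theorem abs_corr_torus_le_far (r : LatticeRep G) {β : ℝ} (hβ : 0 ≤ β) {S : ℕ} {m κ : ℝ} (hm : 0 ≤ m)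
    (hκ : 0 ≤ κ) (hgap : TorusGapAt r.ρ β S m κ) {f g : GaugeConfig 4 (2 * S + 1) G → ℝ}
    (hfm : Measurable f) (hgm : Measurable g) {CA CB : ℝ} (hfb : ∀ U, |f U| ≤ CA) (hgb : ∀ U, |g U| ≤ CB)
    {w₀ : ℕ} (hfd : DependsOn f {e : Edge 4 (2 * S + 1) | ∃ t : ℤ, |t| ≤ w₀ ∧ e.1 0 = (t : ZMod (2 * S + 1))})
    (hgd : DependsOn g {e : Edge 4 (2 * S + 1) | ∃ t : ℤ, |t| ≤ w₀ ∧ e.1 0 = (t : ZMod (2 * S + 1))})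
    (hS : 2 * w₀ + 3 ≤ S) {n : ℕ} (hn₁ : 2 * w₀ + 3 ≤ n) (hn : n ≤ S) :
    |(∫ U, f U * g (torusTimeShift (2 * S + 1) n U) ∂(wilsonMeasure r.ρ β)) -
        (∫ U, f U ∂(wilsonMeasure r.ρ β)) * ∫ U, g U ∂(wilsonMeasure r.ρ β)| ≤
      (4 * (CA ^ 2 + CB ^ 2) + κ * (CA + CB) ^ 2) * Real.exp (m * (2 * w₀ + 3)) *
        Real.exp (-(m * n)) := by
  haveI := isProbabilityMeasure_wilsonMeasure (d := 4) (L := 2 * S + 1) (G := G) r.ρ r.continuous β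
  set μ := wilsonMeasure (d := 4) (L := 2 * S + 1) (G := G) r.ρ β with hμ
  have hCA0 : 0 ≤ CA := (abs_nonneg _).trans (hfb 1)
  have hCB0 : 0 ≤ CB := (abs_nonneg _).trans (hgb 1)
  set s : ℕ := 2 * S - w₀ - 1 with hs
  set j : ℕ := w₀ + 1 with hj
  set N' : ℕ := n - (2 * w₀ + 3) with hN'
  set w : ℕ := 2 * w₀ + 2 with hw
  have hwS : w < S := by omega
  have hN'w : N' + 2 * w ≤ 2 * S + 1 := by omega
  have hjs : (Nat.cast (j + N') : ZMod (2 * S + 1)) = Nat.cast (n + s) := by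
    have : n + s = (j + N') + (2 * S + 1) := by omega
    rw [this, Nat.cast_add (j + N'), ZMod.natCast_self, add_zero]
  have hτ : ∀ i : ℕ, MeasurePreserving (⇑(torusTimeShift (G := G) (2 * S + 1) i)) μ μ := fun i =>
    ⟨(torusTimeShift _ _).measurable, by
      unfold torusTimeShift; exact wilsonMeasure_map_torusConfigShift r.ρ β _⟩
  -- the two slab observables
  set X : GaugeConfig 4 (2 * S + 1) G → ℂ :=
    fun U => (f (torusTimeShift (2 * S + 1) s (GaugeConfig.negReflect U)) : ℂ) with hX
  set Y : GaugeConfig 4 (2 * S + 1) G → ℂ := fun U => (g (torusTimeShift (2 * S + 1) j U) : ℂ) with hY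
  have hXm : Measurable X :=
    Complex.measurable_ofReal.comp ((hfm.comp (torusTimeShift _ s).measurable).comp
      WilsonSiteRP.measurable_negReflect)
  have hYm : Measurable Y := Complex.measurable_ofReal.comp (hgm.comp (torusTimeShift _ j).measurable)
  have hXb : ∀ U, ‖X U‖ ≤ CA := fun U => by
    simp only [hX, Complex.norm_real, Real.norm_eq_abs, hfb]
  have hYb : ∀ U, ‖Y U‖ ≤ CB := fun U => by
    simp only [hY, Complex.norm_real, Real.norm_eq_abs, hgb]
  -- their slab dependence: `f ∘ τ_s` lives at times `2S − 2w₀ − 1 … 2S − 1`, reflected into `1 … w`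
  have hFd : DependsOn (fun U => f (torusTimeShift (2 * S + 1) s U))
      {e : Edge 4 (2 * S + 1) | 2 * S - 2 * w₀ - 1 ≤ (e.1 0).val ∧ (e.1 0).val ≤ 2 * S - 1} :=
    dependsOn_comp_torusTimeShift_slab hfd (by omega) (by omega) (by omega)
  have hXd : DependsOn X {e : Edge 4 (2 * S + 1) | 1 ≤ (e.1 0).val ∧ (e.1 0).val ≤ w} := by
    have h := dependsOn_comp_negReflect_slab' (L := S) (by omega) (by omega) hFd
    refine fun U V hUV => congrArg (fun x : ℝ => (x : ℂ)) (h fun e he => hUV e ?_)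
    simp only [Set.mem_setOf_eq] at he ⊢
    omega
  have hYd : DependsOn Y {e : Edge 4 (2 * S + 1) | 1 ≤ (e.1 0).val ∧ (e.1 0).val ≤ w} := by
    have h := dependsOn_comp_torusTimeShift_slab hgd (j := j) (a := 1) (b := w) (by omega) (by omega)
      (by omega)
    exact fun U V hUV => congrArg (fun x : ℝ => (x : ℂ)) (h hUV)
  -- the identity: `osCorr μ Θ₀ τ_{N'} X Y` is the complexified connected correlation
  have hkey : osCorr μ GaugeConfig.negReflect (torusTimeShift (2 * S + 1) N') X Y =
      (((∫ U, f U * g (torusTimeShift (2 * S + 1) n U) ∂μ) - (∫ U, f U ∂μ) * ∫ U, g U ∂μ : ℝ) : ℂ) := by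
    have h1 : ∀ U, conj (X (GaugeConfig.negReflect U)) * Y (torusTimeShift (2 * S + 1) N' U) =
        ((f (torusTimeShift (2 * S + 1) s U) *
          g (torusTimeShift (2 * S + 1) n (torusTimeShift (2 * S + 1) s U)) : ℝ) : ℂ) := by
      intro U
      simp only [hX, hY, WilsonSiteRP.negReflect_negReflect_config, Complex.conj_ofReal,
        torusTimeShift_torusTimeShift, Complex.ofReal_mul]
      rw [torusTimeShift_congr hjs]
    have hI := (hτ s).integral_comp'
      (fun V => ((f V * g (torusTimeShift (2 * S + 1) n V) : ℝ) : ℂ))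
    have h2 : ∫ U, X U ∂μ = ∫ U, (f U : ℂ) ∂μ :=
      (integral_comp_negReflect_eq r.ρ r.continuous β
        (fun U : GaugeConfig 4 (2 * S + 1) G => (f (torusTimeShift (2 * S + 1) s U) : ℂ))).trans
        ((hτ s).integral_comp' (fun U => (f U : ℂ)))
    have h3 : ∫ U, Y U ∂μ = ∫ U, (g U : ℂ) ∂μ := (hτ j).integral_comp' (fun U => (g U : ℂ))
    unfold osCorr
    rw [integral_congr_ae (ae_of_all _ h1), hI, h2, h3, integral_complex_ofReal, integral_complex_ofReal,
      integral_complex_ofReal, Complex.conj_ofReal]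
    push_cast
    ring
  -- the reflection-positive class of `[1, w]`-slab observables
  set Good : (GaugeConfig 4 (2 * S + 1) G → ℂ) → Prop := fun Z => Measurable Z ∧ (∃ B, ∀ U, ‖Z U‖ ≤ B) ∧
    DependsOn Z {e : Edge 4 (2 * S + 1) | 1 ≤ (e.1 0).val ∧ (e.1 0).val ≤ w} with hGood
  have hadd : ∀ Z Z' (c : ℂ), Good Z → Good Z' → Good (Z + c • Z') := by
    -- adapted from `…TransferHankelSite` (`norm_osCorr_negReflect_pow_le`)
    rintro Z Z' c ⟨hZm, ⟨BZ, hBZ⟩, hZd⟩ ⟨hZ'm, ⟨BZ', hBZ'⟩, hZ'd⟩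
    refine ⟨hZm.add (hZ'm.const_smul c), ⟨BZ + ‖c‖ * BZ', fun U => ?_⟩, fun U V h => ?_⟩
    · rw [Pi.add_apply, Pi.smul_apply, smul_eq_mul]
      refine (norm_add_le _ _).trans (add_le_add (hBZ U) ?_)
      rw [norm_mul]
      exact mul_le_mul_of_nonneg_left (hBZ' U) (norm_nonneg _)
    · simp only [Pi.add_apply, Pi.smul_apply, smul_eq_mul]
      rw [hZd h, hZ'd h]
  have hvar : ∀ Z, Good Z → 0 ≤ osVar μ GaugeConfig.negReflect Z := fun Z hZ =>
    Transfer.HankelSite.osVar_negReflect_nonneg_of_rp_lt r.ρ r.continuous β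
      (stub_negReflectRP r.ρ r.continuous hβ (show 1 ≤ S by omega)) hZ.1 hZ.2.1 hwS hZ.2.2
  have hΦ : ∀ v v' b b' : ℝ, 0 ≤ v → v ≤ v' → 0 ≤ b → b ≤ b' →
      v * Real.exp (-(m * N')) + κ * b ^ 2 * Real.exp (-(m * ((2 * S + 1 : ℝ) - N' - 2 * w))) ≤
        v' * Real.exp (-(m * N')) + κ * b' ^ 2 * Real.exp (-(m * ((2 * S + 1 : ℝ) - N' - 2 * w))) := by
    intro v v' b b' _ hvv' hb hbb'
    have i1 := mul_le_mul_of_nonneg_right hvv' (Real.exp_pos (-(m * N'))).le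
    have i2 := mul_le_mul_of_nonneg_right (mul_le_mul_of_nonneg_left (pow_le_pow_left₀ hb hbb' 2) hκ)
      (Real.exp_pos (-(m * ((2 * S + 1 : ℝ) - N' - 2 * w)))).le
    linarith
  have hpol := Transfer.HankelSite.norm_osCorr_le_of_diag_bound (μ := μ) (Θ := GaugeConfig.negReflect)
    (τ := ⇑(torusTimeShift (2 * S + 1) N')) (Good := Good) WilsonSiteRP.measurable_negReflect
    (torusTimeShift _ _).measurable (fun Z hZ => hZ.1) hadd hvar
    (Φ := fun v b => v * Real.exp (-(m * N')) + κ * b ^ 2 * Real.exp (-(m * ((2 * S + 1 : ℝ) - N' - 2 * w))))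
    hΦ (fun Z B hZ hB => hgap w N' Z B hZ.1 hB hZ.2.2 hwS hN'w)
    ⟨hXm, ⟨CA, hXb⟩, hXd⟩ ⟨hYm, ⟨CB, hYb⟩, hYd⟩ hCA0 hCB0 hXb hYb
  -- the variance terms `osVar ≤ ‖osCorr id Z Z‖ ≤ 2B²`
  have hVX : osVar μ GaugeConfig.negReflect X ≤ 2 * CA ^ 2 :=
    (Complex.re_le_norm _).trans (norm_osCorr_self_le μ _ _ hXb)
  have hVY : osVar μ GaugeConfig.negReflect Y ≤ 2 * CB ^ 2 :=
    (Complex.re_le_norm _).trans (norm_osCorr_self_le μ _ _ hYb)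
  -- the exponents: `N' = n − 2w₀ − 3`, `2S + 1 − N' − 2w = 2S − n − 2w₀ ≥ n − 2w₀ − 3`
  have hN'R : ((N' : ℕ) : ℝ) = (n : ℝ) - (2 * w₀ + 3) := by
    rw [hN', Nat.cast_sub hn₁]; push_cast; ring
  have hwR : ((w : ℕ) : ℝ) = 2 * w₀ + 2 := by
    rw [hw]; push_cast; ring
  have hE2 : Real.exp (-(m * ((2 * S + 1 : ℝ) - N' - 2 * w))) ≤
      Real.exp (m * (2 * w₀ + 3)) * Real.exp (-(m * n)) := by
    rw [← Real.exp_add, Real.exp_le_exp, hN'R, hwR]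
    have hnS : (n : ℝ) ≤ S := by exact_mod_cast hn
    have key : m * ((n : ℝ) + 2 * w₀ - 2 * S) ≤ m * (2 * w₀ + 3 - n) :=
      mul_le_mul_of_nonneg_left (by linarith) hm
    linarith
  have hK2 : 0 ≤ κ * (CA + CB) ^ 2 := by positivity
  rw [← Real.norm_eq_abs, ← Complex.norm_real, ← hkey]
  refine hpol.trans ?_
  have i1 : 2 * (osVar μ GaugeConfig.negReflect X + osVar μ GaugeConfig.negReflect Y) *
      Real.exp (-(m * N')) ≤ 4 * (CA ^ 2 + CB ^ 2) * (Real.exp (m * (2 * w₀ + 3)) * Real.exp (-(m * n))) := by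
    rw [show Real.exp (-(m * N')) = Real.exp (m * (2 * w₀ + 3)) * Real.exp (-(m * n)) by
      rw [← Real.exp_add, hN'R]; ring_nf]
    exact mul_le_mul_of_nonneg_right (by linarith) (by positivity)
  have i2 := mul_le_mul_of_nonneg_left hE2 hK2
  linarith

/-- **On one torus, every separation.** Under `TorusGapAt r.ρ β S m κ` (`β, m, κ ≥ 0`), for species `A`, `B`
whose supports have time half-width `≤ w₀` with `2w₀ + 3 ≤ S`, and every `n ≤ S`:
`|latticeConnectedCorr r.ρ β (2S+1) A.F B.F n| ≤ (4(‖A‖² + ‖B‖²) + κ(‖A‖ + ‖B‖)² + 2‖A‖‖B‖) e^{m(2w₀+3)} e^{−mn}`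
(small `n < 2w₀ + 3` by the trivial bound, large `n` by `abs_corr_torus_le_far`). -/
theorem abs_latticeConnectedCorr_le_of_torusGapAt (r : LatticeRep G) {β : ℝ} (hβ : 0 ≤ β) {S : ℕ}
    {m κ : ℝ} (hm : 0 ≤ m) (hκ : 0 ≤ κ) (hgap : TorusGapAt r.ρ β S m κ) (A B : YMSpecies G)
    {CA CB : ℝ} (hCA : ∀ U, |A.F U| ≤ CA) (hCB : ∀ U, |B.F U| ≤ CB) {w₀ : ℕ}
    (hwA : ∀ e ∈ A.supp, |e.1 0| ≤ (w₀ : ℤ)) (hwB : ∀ e ∈ B.supp, |e.1 0| ≤ (w₀ : ℤ))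
    (hS : 2 * w₀ + 3 ≤ S) {n : ℕ} (hn : n ≤ S) :
    |latticeConnectedCorr r.ρ β (2 * S + 1) A.F B.F n| ≤
      (4 * (CA ^ 2 + CB ^ 2) + κ * (CA + CB) ^ 2 + 2 * (CA * CB)) * Real.exp (m * (2 * w₀ + 3)) *
        Real.exp (-(m * n)) := by
  haveI := isProbabilityMeasure_wilsonMeasure (d := 4) (L := 2 * S + 1) (G := G) r.ρ r.continuous β
  have hCA0 : 0 ≤ CA := (abs_nonneg _).trans (hCA 1)
  have hCB0 : 0 ≤ CB := (abs_nonneg _).trans (hCB 1)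
  have hK1 : 0 ≤ 4 * (CA ^ 2 + CB ^ 2) + κ * (CA + CB) ^ 2 := by positivity
  have hK3 : 0 ≤ 2 * (CA * CB) := by positivity
  have hE : 0 ≤ Real.exp (m * (2 * w₀ + 3)) * Real.exp (-(m * n)) := by positivity
  rw [latticeConnectedCorr_eq_torusTimeShift]
  rcases lt_or_ge n (2 * w₀ + 3) with hlt | hge
  · -- small separations: the trivial bound (`∫ g ∘ τ_n = ∫ g` by translation invariance)
    have hτ : MeasurePreserving (⇑(torusTimeShift (G := G) (2 * S + 1) n))
        (wilsonMeasure (d := 4) (L := 2 * S + 1) r.ρ β) (wilsonMeasure r.ρ β) :=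
      ⟨(torusTimeShift _ _).measurable, by
        unfold torusTimeShift; exact wilsonMeasure_map_torusConfigShift r.ρ β _⟩
    have h1 := abs_corr_le_two_mul (wilsonMeasure (d := 4) (L := 2 * S + 1) (G := G) r.ρ β)
      (f := fun U => A.F (torusLift (2 * S + 1) U))
      (g := fun U => B.F (torusLift (2 * S + 1) (torusTimeShift (2 * S + 1) n U)))
      (fun U => hCA _) (fun U => hCB _)
    rw [hτ.integral_comp' (fun U => B.F (torusLift (2 * S + 1) U))] at h1
    have hE1 : 1 ≤ Real.exp (m * (2 * w₀ + 3)) * Real.exp (-(m * n)) := by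
      rw [← Real.exp_add]
      have hnR : (n : ℝ) ≤ 2 * w₀ + 3 := by exact_mod_cast hlt.le
      exact Real.one_le_exp (by nlinarith [mul_le_mul_of_nonneg_left hnR hm])
    nlinarith [h1, le_mul_of_one_le_right hK3 hE1, mul_nonneg hK1 hE]
  · -- large separations: the reflected OS correlation, polarised
    have h1 := abs_corr_torus_le_far r hβ hm hκ hgap (f := fun U => A.F (torusLift (2 * S + 1) U))
      (g := fun U => B.F (torusLift (2 * S + 1) U)) (A.measurable.comp (measurable_torusLift _))
      (B.measurable.comp (measurable_torusLift _)) (fun U => hCA _) (fun U => hCB _)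
      (dependsOn_torusLift_near hwA _) (dependsOn_torusLift_near hwB _) hS hge hn
    nlinarith [mul_nonneg hK3 hE]

end Torus

/-! ## §3 The registered stub -/

/-- **stub_formatGap** (registered stub of the skeleton `Lines/step_scaling_contraction.lean`, signature
verbatim) — FORMAT, gap half (G-blind plumbing). A rate floor on every torus `S ≥ M^{n_k}` gives the summit's
per-pair sup-norm lattice gap at the same physical rate: for species `A, B` (time half-width `w₀` of the two
supports), eventually in `k` the floor holds, `L_k ≥ M^{n_k} ≥ 2w₀ + 3` (`Negative.eventually_sep_le_L`,
`Negative.tendsto_natPow_of_shape`) and `β_k ≥ 0`; then on every torus `S ≥ L_k`, for `n ≤ S`, the connected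
correlation is a translated, reflected OS correlation of two `[1, 2w₀+2]`-slab observables, polarised on the
reflection-positive class (`stub_negReflectRP`) with the diagonal bound `TorusGapAt` at rate `Δ a_k ≤ Δ`
(`abs_latticeConnectedCorr_le_of_torusGapAt`); pair constant
`(4(‖A‖² + ‖B‖²) + κ(‖A‖ + ‖B‖)² + 2‖A‖‖B‖) e^{Δ(2w₀+3)}`. (Osterwalder–Seiler 1978 §2; Glimm–Jaffe 1987 §6.1,
§19.7.) -/
theorem stub_formatGap :
    ∀ (G : Type) [Group G] [TopologicalSpace G] [IsTopologicalGroup G] [CompactSpace G]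
      [MeasurableSpace G] [BorelSpace G] (r : LatticeRep G) (M : ℕ) (sch : SpeciesScheme (YMSpecies G))
      (n : ℕ → ℕ) (κ Δ : ℝ),
        2 ≤ M → (∀ k, sch.a k = ((M : ℝ) ^ n k)⁻¹) → Tendsto sch.β atTop atTop → 0 ≤ κ → 0 < Δ →
        RateFloor r sch (fun k => M ^ n k) κ Δ → HasLatticeMassGap r sch Δ := by
  intro G _ _ _ _ _ _ r M sch n κ Δ hM ha hβ hκ hΔ hfloor A B
  obtain ⟨CA, hCA⟩ := A.bounded
  obtain ⟨CB, hCB⟩ := B.bounded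
  -- the time half-width of the two supports
  set w₀ : ℕ := (A.supp ∪ B.supp).sup fun e => (e.1 0).natAbs with hw₀
  have hwAB : ∀ e ∈ A.supp ∪ B.supp, |e.1 0| ≤ (w₀ : ℤ) := by
    intro e he
    have h1 : (e.1 0).natAbs ≤ w₀ :=
      Finset.le_sup (f := fun e : Literature.MathematicalPhysics.QuantumLattice.ZdEdge 4 => (e.1 0).natAbs) he
    rw [Int.abs_eq_natAbs]
    exact_mod_cast h1
  have hwA : ∀ e ∈ A.supp, |e.1 0| ≤ (w₀ : ℤ) := fun e he => hwAB e (Finset.mem_union_left _ he)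
  have hwB : ∀ e ∈ B.supp, |e.1 0| ≤ (w₀ : ℤ) := fun e he => hwAB e (Finset.mem_union_right _ he)
  refine ⟨(4 * (CA ^ 2 + CB ^ 2) + κ * (CA + CB) ^ 2 + 2 * (CA * CB)) * Real.exp (Δ * (2 * w₀ + 3)), ?_⟩
  have hK : 0 ≤ 4 * (CA ^ 2 + CB ^ 2) + κ * (CA + CB) ^ 2 + 2 * (CA * CB) := by
    have := (abs_nonneg _).trans (hCA 1); have := (abs_nonneg _).trans (hCB 1); positivity
  have hfloor' : ∀ᶠ k in atTop, ∀ S, M ^ n k ≤ S → TorusGapAt r.ρ (sch.β k) S (Δ * sch.a k) κ := hfloor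
  have hbig : ∀ᶠ k in atTop, ((2 * w₀ + 3 : ℕ) : ℝ) ≤ (M : ℝ) ^ n k :=
    (Negative.tendsto_natPow_of_shape sch ha).eventually_ge_atTop _
  filter_upwards [hfloor', Negative.eventually_sep_le_L sch ha, hβ.eventually_ge_atTop 0, hbig] with k hgapk
    hLk hβk hbigk S hS t ht
  have hw3 : 2 * w₀ + 3 ≤ S := by
    have h1 : 2 * w₀ + 3 ≤ M ^ n k := by exact_mod_cast hbigk
    exact h1.trans (hLk.trans hS)
  have hak1 : sch.a k ≤ 1 := by
    rw [ha k]
    exact inv_le_one_of_one_le₀ (one_le_pow₀ (by exact_mod_cast (by omega : 1 ≤ M)))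
  have hm0 : 0 ≤ Δ * sch.a k := (mul_pos hΔ (sch.a_pos k)).le
  have hmΔ : Δ * sch.a k * (2 * w₀ + 3) ≤ Δ * (2 * w₀ + 3) :=
    mul_le_mul_of_nonneg_right (by nlinarith [sch.a_pos k]) (by positivity)
  have h := abs_latticeConnectedCorr_le_of_torusGapAt r hβk hm0 hκ (hgapk S (hLk.trans hS)) A B hCA hCB
    hwA hwB hw3 ht
  refine h.trans ?_
  rw [show -(Δ * sch.a k * t) = -(Δ * (sch.a k * t)) by rw [mul_assoc]]
  exact mul_le_mul_of_nonneg_right (mul_le_mul_of_nonneg_left (Real.exp_le_exp.2 hmΔ) hK)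
    (Real.exp_pos _).le

end Summit.QuantumFields.YangMills.Cruxes.LatticeGapOnTrajectory.StepScaling

end
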